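import Summits.HubbardSuperconductivity.HubbardSuperconductivity.Theorems.NodalDiracTwistDiskTrivialHolonomyGrid
import Literature.MathematicalPhysics.QuantumLattice.SectorSpectrum

/-!
# Route `NodalDiracTwist` — support `DiskTrivialHolonomy`, part 3: the abstract holonomy theorem

Helper file for stmt-HubbardSuperconductivity-1627 (`DiskTrivialHolonomy`): the abstract form
`re_prod_cyclicOverlap_pos` of the item over a finite index type `ι`, a sector `K ≤ (ι → ℂ)`, a
continuous family `H φ` with the variational lower bound and existence of sector ground states,
and an antiunitary operation `T` preserving `K` and commuting with every `H φ`. Uniqueness of the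
sector ground state on the closed disk `|φ - p| ≤ r` forces the cyclic overlap product of unit
ground states on every fine discretisation of the boundary circle to have positive real part:
`T`-real unit sections make all link variables real (Hatsugai, J. Phys. Soc. Jpn. 75 (2006)
123601), `uniform_overlap` (part 1) makes nearby links close to `±1`, the cells of a fine polar
grid have positive link product (part 2), and the ladder identity `∏ cells = C_k C_{k+1} R²`
propagates positivity of the loop products from the centre (`C_0 = 1`) to the boundary
(Fukui–Hatsugai–Suzuki, J. Phys. Soc. Jpn. 74 (2005) 1674). No new definitions.
-/

-- the mandated namespace `Summit.<Summit>.<Problem>.Theorems` repeats `HubbardSuperconductivity`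
-- (single-problem summit, D-0017), which the `dupNamespace` linter flags on every declaration
set_option linter.dupNamespace false

namespace Summit.HubbardSuperconductivity.HubbardSuperconductivity.Theorems.NodalDiracTwist

open Matrix Complex
open scoped ComplexOrder

variable {ι : Type*} [Fintype ι]

/-- **Trivial holonomy over a disk (abstract form of `DiskTrivialHolonomy`).** Let `H φ` be a
continuous family of matrices acting on the sector `K`, with the variational lower bound `hlb`
and existence `hex` of sector ground states (both hold for Hermitian `H φ` preserving `K ≠ ⊥`),
and let `T` be an ANTIUNITARY operation (`T (c v) = c̄ T v`, `⟨T u, T v⟩ = conj ⟨u, v⟩`)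
preserving `K` and commuting with every `H φ`. If the sector ground state (`GS`, literally the
shape of `IsGroundStateInSector`) is unique up to scalars on the closed disk `|φ - p| ≤ r`, then
for all fine discretisations of the boundary circle and all unit ground-state choices `ψ_i` the
cyclic overlap product `∏ ⟨ψ_i, ψ_{i+1}⟩` has positive real part.
Proof: `T`-real unit sections `s` exist on the disk (`T χ = z χ`, rescale by `√z`), so all link
variables `⟨s_φ, s_φ'⟩` are REAL; by `uniform_overlap` nearby links are close to `±1`, every
cell of a fine polar grid has positive link product (`triangle_re_pos` twice), the product over
the cells between two consecutive circles is `C_k C_{k+1} R²` (radial links cancel in pairs), so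
the loop products `C_k` stay positive from `C_0 = 1` out to the boundary; arbitrary phases cancel
cyclically (`prod_star_smul_dotProduct_smul`). Hatsugai, J. Phys. Soc. Jpn. 75 (2006) 123601
(quantised Berry phase under an antiunitary symmetry); Fukui–Hatsugai–Suzuki, J. Phys. Soc.
Jpn. 74 (2005) 1674 (lattice link variables). [folklore] -/
theorem re_prod_cyclicOverlap_pos (K : Submodule ℂ (ι → ℂ)) (H : (Fin 2 → ℝ) → Matrix ι ι ℂ)
    (hH : Continuous H)
    (hlb : ∀ φ, ∀ v ∈ K, star v ⬝ᵥ v = 1 → (H φ).minEnergyOn K ≤ (star v ⬝ᵥ H φ *ᵥ v).re)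
    (hex : ∀ φ, ∃ v ∈ K, v ≠ 0 ∧ H φ *ᵥ v = (((H φ).minEnergyOn K : ℝ) : ℂ) • v)
    (GS : (Fin 2 → ℝ) → (ι → ℂ) → Prop)
    (hGS : ∀ φ χ, GS φ χ ↔ (χ ∈ K ∧ χ ≠ 0 ∧ H φ *ᵥ χ = (((H φ).minEnergyOn K : ℝ) : ℂ) • χ))
    (T : (ι → ℂ) → (ι → ℂ)) (hTs : ∀ (c : ℂ) (v : ι → ℂ), T (c • v) = star c • T v)
    (hTK : ∀ v ∈ K, T v ∈ K) (hTH : ∀ φ v, T (H φ *ᵥ v) = H φ *ᵥ T v)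
    (hTd : ∀ u v, star (T u) ⬝ᵥ T v = star (star u ⬝ᵥ v))
    (p : Fin 2 → ℝ) {r : ℝ} (hr : 0 < r)
    (huniq : ∀ φ : Fin 2 → ℝ, (φ 0 - p 0) ^ 2 + (φ 1 - p 1) ^ 2 ≤ r ^ 2 →
      ∀ χ₁ χ₂ : ι → ℂ, GS φ χ₁ → GS φ χ₂ → ∃ z : ℂ, χ₂ = z • χ₁) :
    ∃ n₀ : ℕ, ∀ n ≥ n₀, ∀ ψ : Fin n → ι → ℂ,
      (∀ i : Fin n, GS (fun ν : Fin 2 => p ν + r * (if ν = 0 then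
          Real.cos (2 * Real.pi * (i : ℕ) / n) else Real.sin (2 * Real.pi * (i : ℕ) / n))) (ψ i) ∧
        star (ψ i) ⬝ᵥ ψ i = 1) →
      0 < (∏ i : Fin n, star (ψ i) ⬝ᵥ ψ (finRotate n i)).re := by
  classical
  have hpD : (p 0 - p 0) ^ 2 + (p 1 - p 1) ^ 2 ≤ r ^ 2 := by
    rw [sub_self, sub_self, zero_pow two_ne_zero, add_zero]
    positivity
  /- Step 0: `T` preserves ground states; `T`-real unit sections exist on the disk. -/
  have hT0 : ∀ χ : ι → ℂ, χ ≠ 0 → T χ ≠ 0 := by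
    intro χ hχ hT
    apply hχ
    have h := hTd χ χ
    rw [hT, star_zero, zero_dotProduct] at h
    exact dotProduct_star_self_eq_zero.1 (star_eq_zero.1 h.symm)
  have hTGS : ∀ φ χ, GS φ χ → GS φ (T χ) := by
    intro φ χ h
    obtain ⟨hK, h0, hHχ⟩ := (hGS φ χ).1 h
    refine (hGS φ _).2 ⟨hTK χ hK, hT0 χ h0, ?_⟩
    rw [← hTH, hHχ, hTs, Complex.star_def, Complex.conj_ofReal]
  have hsmulGS : ∀ φ χ (c : ℂ), c ≠ 0 → GS φ χ → GS φ (c • χ) := by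
    intro φ χ c hc h
    obtain ⟨hK, h0, hHχ⟩ := (hGS φ χ).1 h
    exact (hGS φ _).2 ⟨K.smul_mem c hK, smul_ne_zero hc h0, by rw [mulVec_smul, hHχ, smul_comm]⟩
  have hsec0 : ∀ φ : Fin 2 → ℝ, (φ 0 - p 0) ^ 2 + (φ 1 - p 1) ^ 2 ≤ r ^ 2 →
      ∃ s : ι → ℂ, GS φ s ∧ star s ⬝ᵥ s = 1 ∧ T s = s := by
    intro φ hφ
    obtain ⟨v, hvK, hv0, hv⟩ := hex φ
    obtain ⟨c, hc0, hc1⟩ := Literature.MathematicalPhysics.QuantumLattice.exists_smul_unit hv0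
    have hχ : GS φ (c • v) := hsmulGS φ v c hc0 ((hGS φ v).2 ⟨hvK, hv0, hv⟩)
    obtain ⟨z, hz⟩ := huniq φ hφ (c • v) (T (c • v)) hχ (hTGS φ _ hχ)
    have hT1 : star (T (c • v)) ⬝ᵥ T (c • v) = 1 := by rw [hTd, hc1, star_one]
    rw [hz] at hT1
    have hz1 : ‖z‖ = 1 := norm_eq_one_of_unit_smul hc1 hT1
    obtain ⟨w, hw⟩ := IsAlgClosed.exists_pow_nat_eq z two_pos
    have hw1 : ‖w‖ = 1 := by
      have h := congrArg norm hw
      rw [norm_pow, hz1] at h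
      exact (pow_eq_one_iff_of_nonneg (norm_nonneg w) two_ne_zero).1 h
    have hw0 : w ≠ 0 := fun h => by
      rw [h, norm_zero] at hw1
      exact zero_ne_one hw1
    refine ⟨w • (c • v), hsmulGS φ _ w hw0 hχ, ?_, ?_⟩
    · rw [star_smul_dotProduct_smul, hc1, hw1, one_pow, Complex.ofReal_one, one_mul]
    · rw [hTs, hz, smul_smul, ← hw]
      congr 1
      calc star w * w ^ 2 = (starRingEnd ℂ w * w) * w := by rw [Complex.star_def]; ring
        _ = w := by rw [Complex.conj_mul', hw1, Complex.ofReal_one, one_pow, one_mul]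
  have hsec1 : ∀ φ : Fin 2 → ℝ, ∃ s : ι → ℂ, ((φ 0 - p 0) ^ 2 + (φ 1 - p 1) ^ 2 ≤ r ^ 2 →
      GS φ s ∧ star s ⬝ᵥ s = 1 ∧ T s = s) := by
    intro φ
    by_cases hφ : (φ 0 - p 0) ^ 2 + (φ 1 - p 1) ^ 2 ≤ r ^ 2
    · obtain ⟨s, hs⟩ := hsec0 φ hφ
      exact ⟨s, fun _ => hs⟩
    · exact ⟨0, fun h => absurd h hφ⟩
  choose sec hsec using hsec1
  -- links between real sections are real, and symmetric
  have hreal : ∀ φ φ', (φ 0 - p 0) ^ 2 + (φ 1 - p 1) ^ 2 ≤ r ^ 2 →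
      (φ' 0 - p 0) ^ 2 + (φ' 1 - p 1) ^ 2 ≤ r ^ 2 →
      star (sec φ) ⬝ᵥ sec φ' = (((star (sec φ) ⬝ᵥ sec φ').re : ℝ) : ℂ) := by
    intro φ φ' hφ hφ'
    have h := hTd (sec φ) (sec φ')
    rw [(hsec φ hφ).2.2, (hsec φ' hφ').2.2, Complex.star_def] at h
    exact (Complex.conj_eq_iff_re.1 h.symm).symm
  /- Step 1: uniform overlap `> 9/10` at scale `δ`. -/
  have huniq' : ∀ φ : Fin 2 → ℝ, (φ 0 - p 0) ^ 2 + (φ 1 - p 1) ^ 2 ≤ r ^ 2 → ∀ χ₁ χ₂ : ι → ℂ,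
      (χ₁ ∈ K ∧ χ₁ ≠ 0 ∧ H φ *ᵥ χ₁ = (((H φ).minEnergyOn K : ℝ) : ℂ) • χ₁) →
      (χ₂ ∈ K ∧ χ₂ ≠ 0 ∧ H φ *ᵥ χ₂ = (((H φ).minEnergyOn K : ℝ) : ℂ) • χ₂) →
      ∃ z : ℂ, χ₂ = z • χ₁ :=
    fun φ hφ χ₁ χ₂ h₁ h₂ => huniq φ hφ χ₁ χ₂ ((hGS _ _).2 h₁) ((hGS _ _).2 h₂)
  obtain ⟨δ, hδ0, hδ⟩ :=
    uniform_overlap K H hH p hr.le hlb huniq' (by norm_num : (0 : ℝ) < 1 / 10)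
  have hov : ∀ φ φ', (φ 0 - p 0) ^ 2 + (φ 1 - p 1) ^ 2 ≤ r ^ 2 →
      (φ' 0 - p 0) ^ 2 + (φ' 1 - p 1) ^ 2 ≤ r ^ 2 → dist φ φ' < δ →
      9 / 10 < ‖star (sec φ) ⬝ᵥ sec φ'‖ ^ 2 := by
    intro φ φ' hφ hφ' hd
    have h := hδ φ φ' hφ hφ' hd (sec φ) (sec φ') ((hGS _ _).1 (hsec φ hφ).1) (hsec φ hφ).2.1
      ((hGS _ _).1 (hsec φ' hφ').1) (hsec φ' hφ').2.1
    linarith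
  /- Step 2: real link variables; triangles and cells of nearby points are positive. -/
  set Lk : (Fin 2 → ℝ) → (Fin 2 → ℝ) → ℝ := fun φ φ' => (star (sec φ) ⬝ᵥ sec φ').re with hLk
  have hLsymm : ∀ φ φ', Lk φ' φ = Lk φ φ' := fun φ φ' => star_dotProduct_comm_re (sec φ) (sec φ')
  have hLself : ∀ φ, (φ 0 - p 0) ^ 2 + (φ 1 - p 1) ^ 2 ≤ r ^ 2 → Lk φ φ = 1 := fun φ hφ => by
    change (star (sec φ) ⬝ᵥ sec φ).re = 1
    rw [(hsec φ hφ).2.1, Complex.one_re]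
  have htri : ∀ a b c, (a 0 - p 0) ^ 2 + (a 1 - p 1) ^ 2 ≤ r ^ 2 →
      (b 0 - p 0) ^ 2 + (b 1 - p 1) ^ 2 ≤ r ^ 2 → (c 0 - p 0) ^ 2 + (c 1 - p 1) ^ 2 ≤ r ^ 2 →
      dist a b < δ → dist a c < δ → 0 < Lk a b * Lk b c * Lk c a := by
    intro a b c ha hb hc hab hac
    have h := triangle_re_pos (hsec a ha).2.1 (hsec b hb).2.1 (hsec c hc).2.1
      (hov a b ha hb hab) (hov a c ha hc hac)
    rw [hreal a b ha hb, hreal b c hb hc, hreal c a hc ha, ← Complex.ofReal_mul,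
      ← Complex.ofReal_mul, Complex.ofReal_re] at h
    exact h
  have hcell : ∀ a b c d, (a 0 - p 0) ^ 2 + (a 1 - p 1) ^ 2 ≤ r ^ 2 →
      (b 0 - p 0) ^ 2 + (b 1 - p 1) ^ 2 ≤ r ^ 2 → (c 0 - p 0) ^ 2 + (c 1 - p 1) ^ 2 ≤ r ^ 2 →
      (d 0 - p 0) ^ 2 + (d 1 - p 1) ^ 2 ≤ r ^ 2 →
      dist a b < δ → dist a c < δ → dist a d < δ →
      0 < Lk a b * Lk b c * Lk c d * Lk d a := by
    intro a b c d ha hb hc hd hab hac had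
    have h12 := mul_pos (htri a b c ha hb hc hab hac) (htri a c d ha hc hd hac had)
    have hkey : Lk a b * Lk b c * Lk c a * (Lk a c * Lk c d * Lk d a) =
        (Lk a b * Lk b c * Lk c d * Lk d a) * (Lk a c * Lk a c) := by
      rw [hLsymm a c]; ring
    rw [hkey] at h12
    exact pos_of_mul_pos_left h12 (mul_self_nonneg _)
  /- Step 3: mesh parameters. -/
  obtain ⟨m, hm⟩ : ∃ m : ℕ, m = ⌈2 * r / δ⌉₊ + 1 := ⟨_, rfl⟩
  have hm0 : 0 < m := by rw [hm]; exact Nat.succ_pos _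
  have hmR : (0 : ℝ) < m := by exact_mod_cast hm0
  have hrm : r / m < δ / 2 := by
    have h1 : 2 * r / δ < m := by
      rw [hm]; push_cast
      exact (Nat.le_ceil _).trans_lt (lt_add_one _)
    rw [div_lt_iff₀ hδ0] at h1
    rw [div_lt_iff₀ hmR]
    linarith
  refine ⟨⌈4 * Real.pi * r / δ⌉₊ + 1, ?_⟩
  intro n hn ψ hψ
  have hn0 : 0 < n := by omega
  have hnR : (0 : ℝ) < n := by exact_mod_cast hn0
  have hrn : r * (2 * Real.pi / n) < δ / 2 := by
    have h1 : (⌈4 * Real.pi * r / δ⌉₊ : ℝ) < n := by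
      exact_mod_cast Nat.lt_of_lt_of_le (Nat.lt_succ_self _) hn
    have h2 : 4 * Real.pi * r / δ < n := (Nat.le_ceil _).trans_lt h1
    rw [div_lt_iff₀ hδ0] at h2
    rw [show r * (2 * Real.pi / n) = 2 * Real.pi * r / n by ring, div_lt_iff₀ hnR]
    linarith
  /- Step 4: the polar grid `v k j = p + (k/m) r (cos 2πj/n, sin 2πj/n)`. -/
  set v : ℕ → ℕ → Fin 2 → ℝ := fun k j ν => p ν + (k : ℝ) / m * r *
    (if ν = 0 then Real.cos (2 * Real.pi * (j : ℝ) / n)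
      else Real.sin (2 * Real.pi * (j : ℝ) / n)) with hv
  have hvD : ∀ k j, k ≤ m → (v k j 0 - p 0) ^ 2 + (v k j 1 - p 1) ^ 2 ≤ r ^ 2 :=
    fun k j hk => polarGrid_mem_disk p r hm0 n hk j
  have hθ : ∀ j : ℕ, |2 * Real.pi * (j : ℝ) / n - 2 * Real.pi * ((j + 1 : ℕ) : ℝ) / n| =
      2 * Real.pi / n := by
    intro j
    rw [Nat.cast_add_one, show 2 * Real.pi * (j : ℝ) / n - 2 * Real.pi * ((j : ℝ) + 1) / n =
      -(2 * Real.pi / n) by ring, abs_neg, abs_of_pos (by positivity)]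
  have hkk : ∀ k : ℕ, |(k : ℝ) / m - ((k + 1 : ℕ) : ℝ) / m| * r = r / m := by
    intro k
    rw [Nat.cast_add_one, show (k : ℝ) / m - ((k : ℝ) + 1) / m = -(1 / m) by ring, abs_neg,
      abs_of_pos (by positivity)]
    ring
  have hd_ab : ∀ k j, k ≤ m → dist (v k j) (v k (j + 1)) < δ := by
    intro k j hk
    refine (dist_polarGrid_le p hr.le hm0 n hk k j (j + 1)).trans_lt ?_
    rw [hθ, sub_self, abs_zero, zero_mul, add_zero]
    linarith
  have hd_ad : ∀ k j, k + 1 ≤ m → dist (v k j) (v (k + 1) j) < δ := by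
    intro k j hk
    refine (dist_polarGrid_le p hr.le hm0 n (Nat.le_of_succ_le hk) (k + 1) j j).trans_lt ?_
    rw [sub_self, abs_zero, mul_zero, zero_add, hkk]
    linarith
  have hd_ac : ∀ k j, k + 1 ≤ m → dist (v k j) (v (k + 1) (j + 1)) < δ := by
    intro k j hk
    refine (dist_polarGrid_le p hr.le hm0 n (Nat.le_of_succ_le hk) (k + 1) j (j + 1)).trans_lt ?_
    rw [hθ, hkk]
    linarith
  -- periodicity in the angular index
  have hvrot : ∀ k (i : Fin n), v k (finRotate n i) = v k ((i : ℕ) + 1) := by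
    intro k i
    have h := dir_finRotate i
    funext ν
    have hν := congrFun h ν
    change p ν + (k : ℝ) / m * r * _ = p ν + (k : ℝ) / m * r * _
    rw [hν]
  /- Step 5: loop products `C k` along the circles of the grid; the ladder. -/
  set C : ℕ → ℝ := fun k => ∏ i : Fin n, Lk (v k i) (v k ((i : ℕ) + 1)) with hC
  have hladder : ∀ k, (∏ i : Fin n, Lk (v k i) (v k ((i : ℕ) + 1)) *
      Lk (v k ((i : ℕ) + 1)) (v (k + 1) ((i : ℕ) + 1)) *
      Lk (v (k + 1) ((i : ℕ) + 1)) (v (k + 1) i) * Lk (v (k + 1) i) (v k i)) =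
      C k * C (k + 1) *
        ((∏ i : Fin n, Lk (v k i) (v (k + 1) i)) * ∏ i : Fin n, Lk (v k i) (v (k + 1) i)) := by
    intro k
    rw [Finset.prod_mul_distrib, Finset.prod_mul_distrib, Finset.prod_mul_distrib]
    have h2 : ∏ i : Fin n, Lk (v k ((i : ℕ) + 1)) (v (k + 1) ((i : ℕ) + 1)) =
        ∏ i : Fin n, Lk (v k i) (v (k + 1) i) := by
      have h : ∀ i : Fin n, Lk (v k ((i : ℕ) + 1)) (v (k + 1) ((i : ℕ) + 1)) =
          Lk (v k (finRotate n i)) (v (k + 1) (finRotate n i)) := by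
        intro i
        rw [hvrot, hvrot]
      rw [Finset.prod_congr rfl fun i _ => h i]
      exact Equiv.prod_comp (finRotate n) (fun i : Fin n => Lk (v k i) (v (k + 1) i))
    have h3 : ∏ i : Fin n, Lk (v (k + 1) ((i : ℕ) + 1)) (v (k + 1) i) = C (k + 1) :=
      Finset.prod_congr rfl fun i _ => hLsymm _ _
    have h4 : ∏ i : Fin n, Lk (v (k + 1) i) (v k i) = ∏ i : Fin n, Lk (v k i) (v (k + 1) i) :=
      Finset.prod_congr rfl fun i _ => hLsymm _ _
    rw [h2, h3, h4]
    change C k * _ * _ * _ = _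
    ring
  have hCpos : ∀ k, k ≤ m → 0 < C k := by
    intro k
    induction k with
    | zero =>
      intro _
      have h0 : ∀ j : ℕ, v 0 j = p := fun j => by
        funext ν
        change p ν + ((0 : ℕ) : ℝ) / m * r * _ = p ν
        rw [Nat.cast_zero, zero_div, zero_mul, zero_mul, add_zero]
      change 0 < ∏ i : Fin n, Lk (v 0 i) (v 0 ((i : ℕ) + 1))
      refine Finset.prod_pos fun i _ => ?_
      rw [h0, h0, hLself p hpD]
      exact one_pos
    | succ k ih =>
      intro hk
      have hk' : k ≤ m := Nat.le_of_succ_le hk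
      have hprod : 0 < ∏ i : Fin n, Lk (v k i) (v k ((i : ℕ) + 1)) *
          Lk (v k ((i : ℕ) + 1)) (v (k + 1) ((i : ℕ) + 1)) *
          Lk (v (k + 1) ((i : ℕ) + 1)) (v (k + 1) i) * Lk (v (k + 1) i) (v k i) :=
        Finset.prod_pos fun i _ => hcell _ _ _ _ (hvD k i hk') (hvD k _ hk') (hvD (k + 1) _ hk)
          (hvD (k + 1) i hk) (hd_ab k i hk') (hd_ac k i hk) (hd_ad k i hk)
      rw [hladder] at hprod
      have h1 : 0 < C k * C (k + 1) := pos_of_mul_pos_left hprod (mul_self_nonneg _)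
      exact pos_of_mul_pos_right h1 (ih hk').le
  /- Step 6: the boundary circle; phases cancel. -/
  have hpt : ∀ i : Fin n, (fun ν : Fin 2 => p ν + r * (if ν = 0 then
      Real.cos (2 * Real.pi * (i : ℕ) / n) else Real.sin (2 * Real.pi * (i : ℕ) / n))) = v m i := by
    intro i
    funext ν
    change _ = p ν + (m : ℝ) / m * r * _
    rw [div_self hmR.ne', one_mul]
  have hψ' : ∀ i : Fin n, GS (v m i) (ψ i) ∧ star (ψ i) ⬝ᵥ ψ i = 1 := fun i => by
    rw [← hpt i]
    exact hψ i
  have hz : ∀ i : Fin n, ∃ z : ℂ, ψ i = z • sec (v m i) := fun i =>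
    huniq (v m i) (hvD m i le_rfl) (sec (v m i)) (ψ i) (hsec _ (hvD m i le_rfl)).1 (hψ' i).1
  choose z hz using hz
  have hz1 : ∀ i, ‖z i‖ = 1 := fun i => by
    have h := (hψ' i).2
    rw [hz i] at h
    exact norm_eq_one_of_unit_smul (hsec _ (hvD m i le_rfl)).2.1 h
  have hprod : ∏ i : Fin n, star (ψ i) ⬝ᵥ ψ (finRotate n i) = ((C m : ℝ) : ℂ) := by
    have h1 : ∏ i : Fin n, star (ψ i) ⬝ᵥ ψ (finRotate n i) =
        ∏ i : Fin n, star (z i • sec (v m i)) ⬝ᵥ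
          (z (finRotate n i) • sec (v m (finRotate n i))) := by
      refine Finset.prod_congr rfl fun i _ => ?_
      rw [← hz i, ← hz (finRotate n i)]
    have h2 := prod_star_smul_dotProduct_smul (finRotate n) z hz1 (fun i : Fin n => sec (v m i))
    rw [h1, h2]
    change _ = (((∏ i : Fin n, Lk (v m i) (v m ((i : ℕ) + 1)) : ℝ)) : ℂ)
    rw [Complex.ofReal_prod]
    refine Finset.prod_congr rfl fun i _ => ?_
    rw [hvrot, hreal _ _ (hvD m i le_rfl) (hvD m _ le_rfl)]
  rw [hprod, Complex.ofReal_re]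
  exact hCpos m le_rfl

end Summit.HubbardSuperconductivity.HubbardSuperconductivity.Theorems.NodalDiracTwist
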